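import Literature.NumberTheory.EllipticCurves.Sprung2012.ColemanPairExistsProofs
import Literature.NumberTheory.EllipticCurves.Sprung2012.ColemanTwistProofs
import Literature.NumberTheory.EllipticCurves.Sprung2012.LocalIwasawaModule
import Summits.BirchSwinnertonDyer.BirchSwinnertonDyer.Theorems.ByReductionTypeAtTwoSupersingularFlatKernelCyclicAlgebra
import HarnessLib

/-!
# Route `ByReductionTypeAtTwo` (rung K4), crux `SupersingularRankZeroAtTwo` (item stmt-BirchSwinnertonDyer-19097), line
# `odd_blind_package`, slot 4 NF♭, sub-hand h13a (hC-loc) of `HAND-TARGETS-NF-1.md`: **the Coleman map `Col = (Col♯, Col♭)` as a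
# `Λ`-LINEAR MAP from the registry's binders ALONE** (levels `hc`, trace relations `htr` for `n ≥ 1`, `p ∣ a_p`, the local lift `g`) —
# hence at `p = 2` with NO Honda-legality clause — and **`Ker Col♭ = Λ ∙ z♭` modulo «`H¹_Iw ≅ Λ²`» and one non-zero ♭ value**
# (cell `bsd-2adic`, LEAD ss-1 GEN 23; `--supports 19097`, helper)

HONEST FRAMING: THEOREMS ONLY (no definition, no named fact, no `sorry`, no instance); generic in the base field, the `ℤ_p`-extension,
the place and `p`.  Nothing about any curve is computed; 19097 OPEN; BSD is proved for no curve.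

WHY: Sprung's existence theorem `Sprung2012.exists_isColemanPair` and the joint map `exists_linearMap_isColemanPair` are typed for a
Honda system `IsHondaSystem κ ι W a_p g c₋ c` with the ODD-`p` bottom relations (`c₀ = (a_p − 2)·c₋`, …), which at `p = 2` differ from
`F1Sign2.IsHondaSystemAtTwo`; but their proofs use ONLY the levels `c_n ∈ E(K_n·K_v)` and the trace relations `Tr_{n+1/n} c_{n+1} =
a_p c_n − c_{n−1}` (`n ≥ 1`) — exactly the binders `hc`, `htr` of the registered ♭ statements of the line.  This file re-cuts them on those
binders, so the Coleman map exists as a `Λ`-linear map for EVERY datum the registry quantifies over (no guard needed for this step):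

* `isQueueSequence_colemanTheta_of_traces` — `(P_{n,c_n}(z))_n` is a queue sequence (Sprung 2012 Prop. 5.5) from `hc` + `htr`;
* `exists_isColemanPair_of_traces` — every functional has a Coleman value (`p ∣ a_p`);
* `exists_linearMap_isColemanPair_of_traces` — under `moduleOfGenerator κ ι W hg`, a `Λ`-LINEAR `J : H¹_Iw(T) → Λ × Λ` with
  `Col(z) = J z` (additivity: `IsColemanPair.add` + uniqueness Prop. 5.7; `Λ`-linearity: `isColemanPair_lambdaSMul`); injectivity NOT claimed;
* `mem_colemanKer_flat_iff_snd_eq_zero` — `Ker Col♭ = ker (snd ∘ J)` as sets (uniqueness);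
* ★ `exists_colemanKer_flat_eq_span_of_linearEquiv_fin_two` — GIVEN `e : H¹_Iw(T) ≃ₗ[Λ] Λ²` (Greenberg 1989 §3 Cor. 2 in the functional
  model; displayed) and ONE functional with non-zero ♭ Coleman value (displayed), `Ker Col♭ = Λ ∙ z♭` (by ★ p822870
  `iwasawaAlgebra_exists_ker_eq_span_singleton_of_linearEquiv_fin_two`: `Λ` factorial, `extract_gcd`).

References: [Sprung2012] Prop. 3.9, 5.3, 5.5, 5.7, Def. 5.9 (pp. 1491–1495), Def. 7.1, 7.9 (pp. 1500, 1503); [Sprung2017] Def. 1.7, Thm. 1.12;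
[Greenberg1989] §3 Cor. 2 (shape of the displayed `e`); [KitajimaOtsuki2018] Prop. 3.29, 3.32.
-/

set_option autoImplicit false
-- the Theorems namespace of this sub repeats the summit name by design (D-0017 nested layout)
set_option linter.dupNamespace false

noncomputable section

open scoped Classical NumberField

open NumberField IsDedekindDomain Polynomial WeierstrassCurve Literature.NumberTheory.EllipticCurves
  Literature.NumberTheory.EllipticCurves.ZpExtension Literature.NumberTheory.EllipticCurves.Sprung2017
  Literature.NumberTheory.EllipticCurves.Kobayashi2003 Literature.NumberTheory.EllipticCurves.Sprung2012
  Literature.NumberTheory.GaloisRepresentations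

universe u

namespace Summit.BirchSwinnertonDyer.BirchSwinnertonDyer.Theorems

namespace OddBlindNF

variable {K : Type u} [Field K] {p : ℕ} [Fact p.Prime] {κ : ZpExtension K p}
variable {E : Type u} [Field E] [Algebra K E] {ι : AlgebraicClosure K →ₐ[K] AlgebraicClosure E}
variable {W : WeierstrassCurve K}

/-! ### §1 Coleman values from levels + traces only -/

/-- **`(P_{n,c_n}(z))_n` is a queue sequence from the LEVELS and the TRACE RELATIONS `n ≥ 1` alone** (the proof of
`Sprung2012.isQueueSequence_colemanTheta` verbatim, its `IsHondaSystem` hypothesis replaced by the two clauses it uses).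
[cite: Sprung2012, Thm. 2.2 (1) (p. 1487) and Prop. 5.5 (p. 1494)] [cite: Sprung2017, Def. 1.7] -/
theorem isQueueSequence_colemanTheta_of_traces {g : Field.absoluteGaloisGroup E}
    (hg : κ.IsTopGenerator (resGalOfEmb ι g)) {ap : ℤ} {c : ℕ → localPoints W E}
    (hcn : ∀ k, c k ∈ localLayerPointsOfEmb κ ι W k)
    (htr : ∀ n, 1 ≤ n → localTraceOfEmb κ ι W n (n + 1) (c (n + 1)) = ap • c n - c (n - 1))
    (z : localTowerPointsOfEmb κ ι W →+ ℤ_[p]) :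
    IsQueueSequence p ap (colemanTheta κ ι W g c z) := by
  intro n
  have hcT : ∀ k, c k ∈ localTowerPointsOfEmb κ ι W := fun k =>
    localLayerPointsOfEmb_le_localTowerPointsOfEmb κ ι W _ (hcn k)
  have htr' : localTraceOfEmb κ ι W (n + 1) (n + 2) (c (n + 2)) = ap • c (n + 1) - c n := by
    have h := htr (n + 1) (Nat.le_add_left 1 n)
    simpa only [Nat.add_sub_cancel] using h
  obtain ⟨q, hq⟩ := omega_dvd_thetaPoly_succ_sub κ ι W hg (hcn (n + 2)) z
  refine ⟨q, ?_⟩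
  rw [colemanTheta_eq_thetaPoly, colemanTheta_eq_thetaPoly, colemanTheta_eq_thetaPoly,
    ← thetaPoly_succ_of_mem_layer κ ι W hg (hcn n), ← thetaPoly_zsmul κ ι W g (n + 1) (hcT (n + 1)),
    sub_add, ← thetaPoly_sub κ ι W g (n + 1) (zsmul_mem (hcT (n + 1)) ap) (hcT n), ← htr']
  exact hq

/-- **Every functional has a Coleman value, from levels + traces + `p ∣ a_p`** (Sprung 2012 Props. 3.9 / 5.3 / 5.5, Def. 5.9, via
`Sprung2017.IsQueueSequence.exists_isChromaticLimit`) — valid verbatim at `p = 2` for the registry's data `(g, c)`.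
[cite: Sprung2012, Prop. 3.9 (p. 1491), Prop. 5.3 and Def. 5.9 (pp. 1493–1495)] [cite: Sprung2017, Thm. 1.12] -/
theorem exists_isColemanPair_of_traces {g : Field.absoluteGaloisGroup E}
    (hg : κ.IsTopGenerator (resGalOfEmb ι g)) {ap : ℤ} (hap : (p : ℤ) ∣ ap) {c : ℕ → localPoints W E}
    (hcn : ∀ k, c k ∈ localLayerPointsOfEmb κ ι W k)
    (htr : ∀ n, 1 ≤ n → localTraceOfEmb κ ι W n (n + 1) (c (n + 1)) = ap • c n - c (n - 1))
    (z : localTowerPointsOfEmb κ ι W →+ ℤ_[p]) :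
    ∃ Lsharp Lflat : IwasawaAlgebra p, IsColemanPair κ ι W ap g c z Lsharp Lflat := by
  obtain ⟨Cs, Cf, h⟩ := (isQueueSequence_colemanTheta_of_traces hg hcn htr z).exists_isChromaticLimit hap
  refine ⟨Cs, Cf, fun m => ?_⟩
  obtain ⟨Q, hQ⟩ := h m
  refine ⟨Q, ?_⟩
  rw [← coe_colemanTheta]
  exact hQ

/-! ### §2 The joint Coleman map as a `Λ`-linear map (no Honda-legality clause) -/

/-- **`Col = (Col♯, Col♭) : H¹_Iw(T) → Λ × Λ` is a well-defined `Λ`-LINEAR map** for the functional model with the `Λ`-structure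
`moduleOfGenerator κ ι W hg`, from `hc`, `htr`, `p ∣ a_p` alone: choose a Coleman value for each `z` (`exists_isColemanPair_of_traces`);
additivity by `IsColemanPair.add` and uniqueness (`IsColemanPair.unique`, Prop. 5.7, needs only `p ∣ a_p`); `Λ`-linearity by
`isColemanPair_lambdaSMul`.  (The tree's `Sprung2012.exists_linearMap_isColemanPair` is the same for an odd-`p` Honda system, with
injectivity; injectivity is NOT claimed here.) [cite: Sprung2012, Def. 5.9 and Prop. 5.7 (p. 1495), Def. 7.1 (p. 1500)] -/
theorem exists_linearMap_isColemanPair_of_traces {g : Field.absoluteGaloisGroup E}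
    (hg : κ.IsTopGenerator (resGalOfEmb ι g)) {ap : ℤ} (hap : (p : ℤ) ∣ ap) {c : ℕ → localPoints W E}
    (hcn : ∀ k, c k ∈ localLayerPointsOfEmb κ ι W k)
    (htr : ∀ n, 1 ≤ n → localTraceOfEmb κ ι W n (n + 1) (c (n + 1)) = ap • c n - c (n - 1)) :
    letI := moduleOfGenerator κ ι W hg
    ∃ J : (localTowerPointsOfEmb κ ι W →+ ℤ_[p]) →ₗ[IwasawaAlgebra p] IwasawaAlgebra p × IwasawaAlgebra p,
      ∀ z, IsColemanPair κ ι W ap g c z (J z).1 (J z).2 := by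
  letI := moduleOfGenerator κ ι W hg
  choose F G hFG using fun z : localTowerPointsOfEmb κ ι W →+ ℤ_[p] ↦ exists_isColemanPair_of_traces hg hap hcn htr z
  refine ⟨{ toFun := fun z ↦ (F z, G z), map_add' := fun z z' ↦ ?_, map_smul' := fun f z ↦ ?_ }, fun z ↦ hFG z⟩
  · obtain ⟨h1, h2⟩ := IsColemanPair.unique κ ι W hap (hFG (z + z')) ((hFG z).add (hFG z'))
    exact Prod.ext h1 h2
  · have hs : IsColemanPair κ ι W ap g c (f • z) (f * F z) (f * G z) := by
      rw [moduleOfGenerator_smul_eq]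
      exact isColemanPair_lambdaSMul hg hcn (hFG z) f
    obtain ⟨h1, h2⟩ := IsColemanPair.unique κ ι W hap (hFG (f • z)) hs
    exact Prod.ext h1 h2

/-- **`Ker Col♭` is the kernel of the ♭ component of ANY such `J`** (uniqueness of Coleman values): for `J` with `Col(z) = J z`,
`z ∈ colemanKer … .flat ⟺ (J z).2 = 0`. [cite: Sprung2012, Def. 7.1 and Def. 7.9 (pp. 1500, 1503), Prop. 5.7 (p. 1495)] -/
theorem mem_colemanKer_flat_iff_snd_eq_zero {g : Field.absoluteGaloisGroup E} {ap : ℤ} (hap : (p : ℤ) ∣ ap)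
    {c : ℕ → localPoints W E} {M : Type*} (J : (localTowerPointsOfEmb κ ι W →+ ℤ_[p]) → M × IwasawaAlgebra p)
    {Js : (localTowerPointsOfEmb κ ι W →+ ℤ_[p]) → IwasawaAlgebra p}
    (hJ : ∀ z, IsColemanPair κ ι W ap g c z (Js z) (J z).2) (z : localTowerPointsOfEmb κ ι W →+ ℤ_[p]) :
    z ∈ colemanKer κ ι W ap g c .flat ↔ (J z).2 = 0 := by
  rw [mem_colemanKer_iff]
  constructor
  · rintro ⟨Ls, Lf, hz, hL⟩
    obtain ⟨-, h2⟩ := IsColemanPair.unique κ ι W hap (hJ z) hz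
    rw [h2]
    exact hL
  · intro h
    exact ⟨Js z, (J z).2, hJ z, h⟩

/-! ### §3 ★ `Ker Col♭ = Λ ∙ z♭` modulo «`H¹_Iw ≅ Λ²`» and one non-zero ♭ value -/

/-- ★ **(h13a, kernel form) `Ker Col♭` is CYCLIC** for every datum `(g, c)` of the registry (levels `hc`, traces `htr`, `p ∣ a_p`, local
lift `g` of the generator), GIVEN (i) a `Λ`-linear isomorphism `e : H¹_Iw(T) ≃ Λ²` of the functional model (Greenberg 1989 §3 Cor. 2
/ Kitajima–Otsuki Prop. 3.29: `H¹(K_∞·K_v, E[p^∞])^∨` is `Λ`-free of rank `2[K_v:ℚ_p]` when `E(K_∞·K_v)[p^∞] = 0` — DISPLAYED) and (ii) ONE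
functional `z₁` with a non-zero ♭ Coleman value (DISPLAYED; e.g. any `z₁` with `z₁(c₀) ≠ 0`, as `L♭ ≡ −z(c₀) mod T`): then
`colemanKer … .flat = ↑(Λ ∙ z♭)` for some `z♭`.  Proof: `Col♭ = snd ∘ J` is a non-zero `Λ`-linear form on a module `≃ Λ²`; its kernel is
cyclic by `iwasawaAlgebra_exists_ker_eq_span_singleton_of_linearEquiv_fin_two` (p822870: `Λ = ℤ_p⟦T⟧` is factorial).
[cite: KitajimaOtsuki2018, Prop. 3.29 and Prop. 3.32 (arXiv:1607.03612 p. 16)] [cite: Sprung2012, Def. 7.9 (p. 1503)] -/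
theorem exists_colemanKer_flat_eq_span_of_linearEquiv_fin_two {g : Field.absoluteGaloisGroup E}
    (hg : κ.IsTopGenerator (resGalOfEmb ι g)) {ap : ℤ} (hap : (p : ℤ) ∣ ap) {c : ℕ → localPoints W E}
    (hcn : ∀ k, c k ∈ localLayerPointsOfEmb κ ι W k)
    (htr : ∀ n, 1 ≤ n → localTraceOfEmb κ ι W n (n + 1) (c (n + 1)) = ap • c n - c (n - 1))
    (e : letI := moduleOfGenerator κ ι W hg
      (localTowerPointsOfEmb κ ι W →+ ℤ_[p]) ≃ₗ[IwasawaAlgebra p] (Fin 2 → IwasawaAlgebra p))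
    (hne : ∃ (z₁ : localTowerPointsOfEmb κ ι W →+ ℤ_[p]) (Ls Lf : IwasawaAlgebra p),
      IsColemanPair κ ι W ap g c z₁ Ls Lf ∧ Lf ≠ 0) :
    letI := moduleOfGenerator κ ι W hg
    ∃ zf : localTowerPointsOfEmb κ ι W →+ ℤ_[p],
      colemanKer κ ι W ap g c .flat = (Submodule.span (IwasawaAlgebra p) {zf} : Set _) := by
  letI := moduleOfGenerator κ ι W hg
  obtain ⟨J, hJ⟩ := exists_linearMap_isColemanPair_of_traces hg hap hcn htr
  -- `Col♭ = snd ∘ J`, a non-zero `Λ`-linear form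
  set Cf : (localTowerPointsOfEmb κ ι W →+ ℤ_[p]) →ₗ[IwasawaAlgebra p] IwasawaAlgebra p :=
    (LinearMap.snd (IwasawaAlgebra p) (IwasawaAlgebra p) (IwasawaAlgebra p)).comp J with hCf
  have hCf0 : Cf ≠ 0 := by
    obtain ⟨z₁, Ls, Lf, h1, hLf⟩ := hne
    intro h0
    obtain ⟨-, h2⟩ := IsColemanPair.unique κ ι W hap (hJ z₁) h1
    apply hLf
    rw [← h2]
    exact (LinearMap.congr_fun h0 z₁ : Cf z₁ = 0)
  obtain ⟨zf, hzf⟩ := iwasawaAlgebra_exists_ker_eq_span_singleton_of_linearEquiv_fin_two p e Cf hCf0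
  refine ⟨zf, ?_⟩
  ext z
  rw [mem_colemanKer_flat_iff_snd_eq_zero hap (fun z ↦ J z) (fun z ↦ (hJ z)) z, SetLike.mem_coe, ← hzf, LinearMap.mem_ker]
  rfl

end OddBlindNF

end Summit.BirchSwinnertonDyer.BirchSwinnertonDyer.Theorems

end
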